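import Summits.QuantumFields.YangMills.Theorems.BalabanUVNodesN11CondExpFibreSectionsOmega
import Summits.QuantumFields.YangMills.Theorems.BalabanUVNodesN11O3OfFibrewiseIdentityAtRecord13

/-!
# DAG node N11 — THE (O3′) CLAUSE AT THE STAGE-13 LETTERS FROM THE ONE-FIBRE CONDITIONAL-EXPECTATION IDENTITY: per old branch `S₀` and a.e. frozen retained configuration `y`,
# «def-T's conditional expectation, on ONE fibre of the inside variables along the inside averaging, of the frozen old piece IS 11a's intrinsic reading `R̃_{S₀}(y,·)`» — no tests, no charts

HEADER — WORK-UNIT METADATA.  Cell `pub-ymgap`, YM-PLAN Track A (D-0062), seat `pub-ymgap-dag-n11-d` (g17; N11 [B14], s2), route `BalabanUVNodes`, item K1⁹ = stmt-QuantumFields-27364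
(helper lane, `--kind proof --supports 27364 --as helper`, count-neutral).  [I] = [Balaban1987RG1], [II] = [Balaban1988RG2Cluster], [III] = [Balaban1988Convergent].  Over dag-n11-e g23's
`…N11CondExpFibreSections[Omega]` (p653309 + sequel: the FIBREWISE absolute continuity of the inside averaging for EVERY frozen `y`, `map_pi_avOfRecord_glue_fibre_absolutelyContinuous_Omega`;
the sections of the skew conditional expectation ARE the fibre transports) and def-T's `integral_kernelTransport_mul`: §0 here derives (hfib) from the one-fibre kernel-transport identity
(`fibrewise_at_record_of_fibreTransport_ae_eq`, candidate CURRIED so callers unify by pattern) plus two generic [folklore] helpers (PULL-OUT of functions of the new variables; a socket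
chart from a measurable re-coordinatisation); §1–§2 are the Stage-13 editions over p646357 ∕ p650104's row discharges; then p639540 ∕ p640513 by name.

WHY THIS FILE.  The chain g15 → g17 presented the analytic content of (O3′) successively as: a charted inner identification; a joint conditional expectation (hce₀); a weak identity;
a frozen-`y` fibrewise identity; charts + readings.  With dag-n11-e g23's fibrewise absolute continuity (and `condExp_iff_fibrewise_Omega`) the cleanest INTRINSIC form is available and equivalent to all of them: per `(s′, S₀)` and
a.e. frozen `y`, ON ONE FIBRE `(B_k-bonds off Ω^c_{k+1} → SU(N))` with its product Haar measure and the inside averaging `A_y : u ↦ Ū(e⁻¹(y,u))|_{B_{k+1}(Ω_{k+1})}` (absolutely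
continuous push-forward, every `y`), def-T's kernel transport of the frozen piece `u ↦ piece_{S₀}(e⁻¹(y,u))` IS `R̃_{S₀}(y,·)` a.e. — print's «∫ dU|_{Ω_{k+1}} δ(VŪ⁻¹)(old density)
= (3.23)'s right member» at frozen `U|_{Ω^c_{k+1}}` ([III] pp.267–270; [I] Thm 1 + [II] at the first step).  THIS FILE states the (O3′) clause with exactly that displayed.

WHAT THIS FILE PROVES (0 `def`, 0 `sorry`, standard axioms).  §0 generic [folklore]: ★ `fibre_identity_of_fibreTransport_ae_eq` (one fibre: `kernelTransport ν μ₂ avg ρ =ᵐ R` ⟹ the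
identity for all bounded measurable tests — def-T's push-forward identity + `integral_congr_ae`) · ★★ `kernelTransport_mul_comp_ae_eq` (PULL-OUT: `kernelTransport (f∘avg·g) =ᵐ f·kernelTransport g`)
· ★ `chart_of_measurableEquiv` (a chart for `…N11FibrewiseIdentityOfFibreChart`'s socket from `Φ : U ≃ᵐ V × Z` reading `avg` in its first component with IMAGE LAW `ν.map Φ = m.withDensity J`);
record ★★★ `fibrewise_at_record_of_fibreTransport_ae_eq` ((hfib) at 11a's letters from «∀ᵐ y, the one-fibre kernel transport of the frozen piece IS `R y`», curried candidate).
§1 ★★★ `slotsTOfRecord₁₃H_succ_O3_of_hasSect2FormAtZS_of_fibreCondExp_of_provisos` (Stage 13, every level `k < K`).  §2 ★★★ `slotsTOfRecord₁₃H_one_O3_of_fibreCondExpRho_of_provisos`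
(the first 𝐓-step, old piece `w(s′)·ρ₀`).

HONEST FRAMING.  Helper lane of K1⁹; count-neutral; compositions BY NAME; the one-fibre identity is DISPLAYED — it IS [I] §2 + [15] Sect. C + ζ + [III] Thm 2 ([I] Thm 1 + [II] at the
first step), NOT proved; nothing of Bałaban asserted; N11 NOT discharged; K1⁹ NOT closed, no registered stub touched; counts unmoved (typed 28∕28 · discharged 5∕27 · A 5∕28).  One finite
`𝕋⁴_{L^K}` programme at fixed `ε = L^{−K}` — NOT ℝ⁴, NOT OS, NOT a mass gap, NOT Clay.  No `sorry`, `axiom`, `def`, `instance`, `notation`.  Sources (SHAPE only): [III] Thm 1 p.262,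
Thm 2 p.263, (2.18) p.257, (2.20)–(2.21) p.258, (3.1) p.264, (3.10)–(3.11) p.266, (3.12)–(3.14) p.267, (3.23)–(3.25) p.270, §3 p.279; [I] Thm 1 p.258, (0.4) p.253, §2 p.267.
-/

noncomputable section

open MeasureTheory ProbabilityTheory
open scoped ENNReal NNReal BigOperators Matrix.Norms.L2Operator

namespace Summit.QuantumFields.YangMills.Theorems.BalabanUVNodesN11O3OfFibreCondExpAtRecord13

open Literature.MathematicalPhysics.QuantumFieldTheory.Balaban1983to89
open Literature.MathematicalPhysics.QuantumFieldTheory.Balaban1983to89.T4AveragingDisintegration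
open BalabanUVNodesN11CondExpOfFibrewiseIdentity (condExp_identity_of_fibrewise_of_nonneg)
open BalabanUVNodesN11CondExpFibreSectionsOmega (map_pi_avOfRecord_glue_fibre_absolutelyContinuous_Omega)
open BalabanUVNodesN11O3OfIntrinsicReading (measurable_intrinsicReading_of_hgm)
open BalabanUVNodesN11O3OfIntrinsicReadingAtRecord13 (slotsTOfRecord₁₃H_succ_O3_of_hasSect2FormAtZS_of_oldBranchCondExp_of_provisos)
open BalabanUVNodesN11FirstTStepO3OfIntrinsicReading (slotsTOfRecord₁₃H_one_O3_of_condExpRho_of_provisos)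
open BalabanUVNodesN11TStepGraphIntegrableOfProvisos (hG_at_record₁₃_of_provisos)
open BalabanUVNodesN11TStepOldBranchGraphIntegrable (integrable_oldBranch_pieces₁₃H_of_integrable_graph tkBranchOfRecord_nonneg)
open BalabanUVNodesN11TStepBranchSumAtRecord13OfLaws (hgm_at_record₁₃_of_rows)
open N21StepWeightsPositivity (zetaOfRecord_nonneg)
open Literature.MathematicalPhysics.QuantumFieldTheory.Balaban1983to89.B14SeparationOfRecord (slotsTOfRecord_succ_eq_zero_of_init_eq_zero)
open Node00 hiding SU
open Node00.Tk T4Continuum B14.Eq218Concrete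
open B10Eq42TorusConstraint (bondsIn)

variable {F : T4Family} {N : ℕ} [NeZero N]

/-! ## §0  Generic [folklore] helpers and the (hfib)-producer at 11a's letters -/

section Generic

variable {U V Z : Type*} [MeasurableSpace U] [MeasurableSpace V] [MeasurableSpace Z]

/-- ★ **ONE FIBRE: `kernelTransport ν μ₂ avg ρ =ᵐ[μ₂] R` ⟹ «∀ bounded measurable `h`, ∫ ρ·h∘avg dν = ∫ R·h dμ₂»** (def-T's push-forward identity `integral_kernelTransport_mul`, then
`integral_congr_ae`; `ρ` integrable, `ν.map avg ≪ μ₂`; nothing asked of `R`). [folklore] -/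
theorem fibre_identity_of_fibreTransport_ae_eq [StandardBorelSpace U] [Nonempty U] (ν : Measure U) [IsFiniteMeasure ν] (μ₂ : Measure V) [SigmaFinite μ₂]
    {avg : U → V} (havg : Measurable avg) (hac : ν.map avg ≪ μ₂) {ρ : U → ℝ} (hρ : Integrable ρ ν) {R : V → ℝ}
    (hT : kernelTransport ν μ₂ avg ρ =ᵐ[μ₂] R) (h : V → ℝ) (hh : Measurable h) (hC : ∃ C : ℝ, ∀ v, |h v| ≤ C) :
    ∫ u, ρ u * h (avg u) ∂ν = ∫ v, R v * h v ∂μ₂ := by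
  obtain ⟨C, hC⟩ := hC
  rw [← integral_kernelTransport_mul ν μ₂ havg hac hρ hh hC]
  exact integral_congr_ae (hT.mono fun v hv => show kernelTransport ν μ₂ avg ρ v * h v = R v * h v by rw [hv])

/-- ★★ **PULL-OUT: functions of the NEW variables factor out of the one-fibre conditional expectation** — `kernelTransport ν μ₂ avg (f∘avg · g) =ᵐ f · kernelTransport ν μ₂ avg g`
for `g` integrable and `f` bounded measurable (both sides pair identically with every bounded measurable test; a.e. uniqueness).  At a frozen `y` every factor of the old piece
reading only `(y, Ū|_{new})` — the new small-field characteristic functions, the new main action — comes out of the fibre transport. [folklore] -/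
theorem kernelTransport_mul_comp_ae_eq [StandardBorelSpace U] [Nonempty U] (ν : Measure U) [IsFiniteMeasure ν] (μ₂ : Measure V) [SigmaFinite μ₂]
    {avg : U → V} (havg : Measurable avg) (hac : ν.map avg ≪ μ₂)
    {g : U → ℝ} (hg : Integrable g ν) {f : V → ℝ} (hf : Measurable f) (hfC : ∃ C : ℝ, ∀ v, |f v| ≤ C) :
    kernelTransport ν μ₂ avg (fun u => f (avg u) * g u) =ᵐ[μ₂] fun v => f v * kernelTransport ν μ₂ avg g v := by
  obtain ⟨C, hC⟩ := hfC
  have hfg : Integrable (fun u => f (avg u) * g u) ν :=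
    hg.bdd_mul (c := C) (hf.comp havg).aestronglyMeasurable (Filter.Eventually.of_forall fun u => by
      simpa only [Function.comp_apply, Real.norm_eq_abs] using hC (avg u))
  have hT := integrable_kernelTransport ν μ₂ havg hac hg
  have hfT : Integrable (fun v => f v * kernelTransport ν μ₂ avg g v) μ₂ :=
    hT.bdd_mul (c := C) hf.aestronglyMeasurable (Filter.Eventually.of_forall fun v => by simpa only [Real.norm_eq_abs] using hC v)
  refine ae_eq_of_forall_integral_mul_eq (integrable_kernelTransport ν μ₂ havg hac hfg) hfT fun h hh hhC => ?_
  obtain ⟨D, hD⟩ := hhC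
  have hfh : Measurable fun v => f v * h v := hf.mul hh
  have hfhC : ∀ v, |f v * h v| ≤ C * D := fun v => by
    rw [abs_mul]; exact mul_le_mul (hC v) (hD v) (abs_nonneg _) ((abs_nonneg _).trans (hC v))
  rw [integral_kernelTransport_mul ν μ₂ havg hac hfg hh hD]
  have h2 := integral_kernelTransport_mul ν μ₂ havg hac hg hfh hfhC
  calc ∫ u, f (avg u) * g u * h (avg u) ∂ν = ∫ u, g u * (f (avg u) * h (avg u)) ∂ν :=
        integral_congr_ae (ae_of_all _ fun u => by ring)
    _ = ∫ v, kernelTransport ν μ₂ avg g v * (f v * h v) ∂μ₂ := h2.symm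
    _ = ∫ v, f v * kernelTransport ν μ₂ avg g v * h v ∂μ₂ := integral_congr_ae (ae_of_all _ fun v => by ring)

/-- ★ **A CHART FOR THE FROZEN-`y` SOCKET (`…N11FibrewiseIdentityOfFibreChart`) FROM A MEASURABLE RE-COORDINATISATION**: if `Φ : U ≃ᵐ V × Z` reads the averaging in its first
component and the IMAGE LAW of `ν` under `Φ` has density `J` for a reference `m` (`ν.map Φ = m.withDensity J` — the analyst's Jacobian: the law of (new averages, fibre
coordinates) under product Haar), then `Ψ := Φ⁻¹`, `J` satisfy `hpush` (charted set `univ`) and `hsec` (even everywhere). [folklore] -/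
theorem chart_of_measurableEquiv (ν : Measure U) (m : Measure (V × Z)) {avg : U → V} (Φ : U ≃ᵐ V × Z)
    (hΦ : ∀ u, (Φ u).1 = avg u) {J : V × Z → ℝ≥0∞} (hlaw : ν.map Φ = m.withDensity J) :
    (m.withDensity J).map Φ.symm = ν ∧ ∀ᵐ z ∂(m.withDensity J), avg (Φ.symm z) = z.1 := by
  refine ⟨?_, ae_of_all _ fun z => by rw [← hΦ (Φ.symm z), Φ.apply_symm_apply]⟩
  rw [← hlaw, Measure.map_map Φ.symm.measurable Φ.measurable, Φ.symm_comp_self, Measure.map_id]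

end Generic

/-- ★★★ **(hfib) OF `…N11CondExpOfFibrewiseIdentity` FROM THE ONE-FIBRE CONDITIONAL-EXPECTATION IDENTITY**, at 11a's generation letters, for ANY `dU`-integrable `ρ`: if for a.e.
frozen `y` def-T's kernel transport of `u ↦ ρ(e⁻¹(y,u))` along the inside averaging `u ↦ Ū(e⁻¹(y,u))|_{new}` IS `R y` a.e., then the frozen-`y` fibrewise identity holds — the
absolute continuity on EVERY fibre is dag-n11-e g23's `map_pi_avOfRecord_glue_fibre_absolutelyContinuous_Omega`; the candidate is CURRIED (`R y v`) so that callers' candidates unify by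
pattern. [cite: Balaban1987RG1, (0.4) p.253, §2 p.267; Balaban1988Convergent, (2.21) p.258, (3.1) p.264, (3.23)–(3.25) p.270] -/
theorem fibrewise_at_record_of_fibreTransport_ae_eq {ν : Stage7Numerics} {M : ℕ} {g : ℕ → ℝ} (K : ℕ) {k n : ℕ} (s : SeqOfRecord F ν M g K n)
    [DecidableEq (PBond (F.P K) k)] [DecidableEq (PBond (F.P K) (k + 1))] (hk : k + 1 ≤ (F.P K).m + (F.P K).K)
    {ρ : GaugeField (F.P K) k (SU N) → ℝ} (hρ : Integrable ρ (fieldMeasure (F.P K) k (SU N)))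
    {R : (↥(Set.toFinite (bondsIn k (s.Ω (k + 1))ᶜ)).toFinset → SU N) →
      ({c : PBond (F.P K) (k + 1) // c ∉ (Set.toFinite (bondsIn (k + 1) (s.Ω (k + 1))ᶜ)).toFinset} → SU N) → ℝ}
    (hT : ∀ᵐ y ∂(Measure.pi fun _ : ↥(Set.toFinite (bondsIn k (s.Ω (k + 1))ᶜ)).toFinset => (HaarData.haar : Measure (SU N))),
      kernelTransport (Measure.pi fun _ : {b : PBond (F.P K) k // b ∉ (Set.toFinite (bondsIn k (s.Ω (k + 1))ᶜ)).toFinset} => (HaarData.haar : Measure (SU N)))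
          (Measure.pi fun _ : {c : PBond (F.P K) (k + 1) // c ∉ (Set.toFinite (bondsIn (k + 1) (s.Ω (k + 1))ᶜ)).toFinset} => (HaarData.haar : Measure (SU N)))
          (fun u => fun c : {c : PBond (F.P K) (k + 1) // c ∉ (Set.toFinite (bondsIn (k + 1) (s.Ω (k + 1))ᶜ)).toFinset} =>
            (avOfRecord F N K k).avg ((MeasurableEquiv.piEquivPiSubtypeProd (fun _ : PBond (F.P K) k => SU N)
              (· ∈ (Set.toFinite (bondsIn k (s.Ω (k + 1))ᶜ)).toFinset)).symm (y, u)) c)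
          (fun u => ρ ((MeasurableEquiv.piEquivPiSubtypeProd (fun _ : PBond (F.P K) k => SU N)
              (· ∈ (Set.toFinite (bondsIn k (s.Ω (k + 1))ᶜ)).toFinset)).symm (y, u)))
        =ᵐ[Measure.pi fun _ : {c : PBond (F.P K) (k + 1) // c ∉ (Set.toFinite (bondsIn (k + 1) (s.Ω (k + 1))ᶜ)).toFinset} => (HaarData.haar : Measure (SU N))]
        fun v => R y v) :
    ∀ᵐ y ∂(Measure.pi fun _ : ↥(Set.toFinite (bondsIn k (s.Ω (k + 1))ᶜ)).toFinset => (HaarData.haar : Measure (SU N))),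
      ∀ h : ({c : PBond (F.P K) (k + 1) // c ∉ (Set.toFinite (bondsIn (k + 1) (s.Ω (k + 1))ᶜ)).toFinset} → SU N) → ℝ, Measurable h → (∃ C : ℝ, ∀ v, |h v| ≤ C) →
        ∫ u, ρ ((MeasurableEquiv.piEquivPiSubtypeProd (fun _ : PBond (F.P K) k => SU N)
              (· ∈ (Set.toFinite (bondsIn k (s.Ω (k + 1))ᶜ)).toFinset)).symm (y, u)) *
            h (fun c : {c : PBond (F.P K) (k + 1) // c ∉ (Set.toFinite (bondsIn (k + 1) (s.Ω (k + 1))ᶜ)).toFinset} =>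
              (avOfRecord F N K k).avg ((MeasurableEquiv.piEquivPiSubtypeProd (fun _ : PBond (F.P K) k => SU N)
                (· ∈ (Set.toFinite (bondsIn k (s.Ω (k + 1))ᶜ)).toFinset)).symm (y, u)) c)
          ∂(Measure.pi fun _ : {b : PBond (F.P K) k // b ∉ (Set.toFinite (bondsIn k (s.Ω (k + 1))ᶜ)).toFinset} => (HaarData.haar : Measure (SU N))) =
        ∫ v, R y v * h v ∂(Measure.pi fun _ : {c : PBond (F.P K) (k + 1) // c ∉ (Set.toFinite (bondsIn (k + 1) (s.Ω (k + 1))ᶜ)).toFinset} =>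
          (HaarData.haar : Measure (SU N))) := by
  have hpres := measurePreserving_piEquivPiSubtypeProd_symm_fieldMeasure (G := SU N) (P := F.P K) (j := k) (Set.toFinite (bondsIn k (s.Ω (k + 1))ᶜ)).toFinset
  have hρ' := (hpres.integrable_comp hρ.aestronglyMeasurable).mpr hρ
  have hφ := measurable_avOfRecord_glue_rest F N K k (Set.toFinite (bondsIn k (s.Ω (k + 1))ᶜ)).toFinset (Set.toFinite (bondsIn (k + 1) (s.Ω (k + 1))ᶜ)).toFinset
  filter_upwards [hT, hρ'.prod_right_ae] with y hy hρy h hh hC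
  exact fibre_identity_of_fibreTransport_ae_eq _ _ (hφ.comp measurable_prodMk_left)
    (map_pi_avOfRecord_glue_fibre_absolutelyContinuous_Omega (F := F) (N := N) K s k hk y) hρy hy h hh hC

/-! ## §1  Stage-13 letters at the core provisos: the (O3′) disjunction from the one-fibre conditional-expectation identity, per old branch -/

section Stage13
/-- ★★★ **THE (O3′) DISJUNCTION OF `PresentChildObligations` FROM THEOREM 1's LEVEL-`k` FORM, THE CORE PROVISOS, ROWS, AND — PER OLD BRANCH, a.e. FROZEN `y` — THE ONE-FIBRE
CONDITIONAL-EXPECTATION IDENTITY `kernelTransport_y(piece_{S₀,y}) =ᵐ R̃_{S₀}(y,·)`** (the frozen-`y` identity produced by §0's `fibrewise_at_record_of_fibreTransport_ae_eq`) —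
p646357 §2 with the weak identity produced by the Fubini reduction `condExp_identity_of_fibrewise_of_nonneg` (`R̃_{S₀} ≥ 0`, measurable, the piece `dU`-integrable: theorems of the
provisos as there).  The displayed identity: for a.e. frozen `y = U|_{B_k(Ω^c_{k+1})}` and every bounded measurable `h` of the new variables `v₂` alone,
`∫ piece_{S₀}(e⁻¹(y,u))·h(Ū(e⁻¹(y,u))|_{new}) du = ∫ R̃_{S₀}(y,v₂)·h(v₂) dv₂`. [cite: Balaban1988Convergent, Thm 1 p.262, Thm 2 p.263, §3 p.279, (3.1) p.264, (3.10)–(3.11) p.266, (3.12)–(3.14) p.267, (3.23)–(3.25) p.270; Balaban1987RG1, (0.4) p.253, §2 p.267] -/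
theorem slotsTOfRecord₁₃H_succ_O3_of_hasSect2FormAtZS_of_fibreCondExp_of_provisos (θ : Stage13HParams F N) (h : θ.Provisos₁₃CoPH F N)
    (p : B12.RunParams) {k : ℕ} (hkK : k < p.K)
    {hdec : DecidableEq (PBond (F.P p.K) k)} {hdec' : DecidableEq (PBond (F.P p.K) (k + 1))} (hk : k + 1 ≤ (F.P p.K).m + (F.P p.K).K)
    (s' : SeqOfRecord F θ.ν θ.τ9.M (gOfRecord₁₃ F N θ.toStage13Params p) p.K (k + 1))
    {law : SeqOfRecord F θ.ν θ.τ9.M (gOfRecord₁₃ F N θ.toStage13Params p) p.K k → Sect2.TermValues (F.P p.K) (MatA N) (FluctV N) θ.τ9.M → Prop}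
    {t : SeqOfRecord F θ.ν θ.τ9.M (gOfRecord₁₃ F N θ.toStage13Params p) p.K k → Sect2.TermValues (F.P p.K) (MatA N) (FluctV N) θ.τ9.M}
    {Ek : SeqOfRecord F θ.ν θ.τ9.M (gOfRecord₁₃ F N θ.toStage13Params p) p.K k → ℝ}
    (hform : HasSect2FormAtZS F N (FluctV N) p.K (settingOfRecord₁₃ F N θ.toStage13Params p) k (θ.rzAt p) (WtOfRecord₁₃H F N θ p)
      (UbgOfRecord₁₃CoP F N θ.toStage13Params p k) law
      (slotsOfRecord F N θ.ν θ.τ9 (EOfRecord₁₃ F N θ.toStage13Params) (wOfRecord₉ F N θ.toStage9Params) θ.ppSel p (gOfRecord₁₃ F N θ.toStage13Params p) k) t Ek)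
    (t' : Sect2.TermValues (F.P p.K) (MatA N) (FluctV N) θ.τ9.M) (E' : ℝ)
    (hζ0m : ∀ j Y, Measurable ((θ.zhAt p s'.init).ζ0 j Y)) (hqm : ∀ j Λ', Measurable ((θ.zhAt p s'.init).quad j Λ'))
    (hΦ₀m : ∀ S₀ ∈ admSOfRecord F θ.ν θ.τ9.M (gOfRecord₁₃ F N θ.toStage13Params p) p.K k s'.init,
      Measurable fun ω : MultiCfg (F.P p.K) (SU N) (FluctV N) =>
        (sect2Operand F N (FluctV N) p.K (settingOfRecord₁₃ F N θ.toStage13Params p) (θ.rzAt p s'.init) s'.init (t s'.init) (Ek s'.init)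
            (UbgOfRecord₁₃CoP F N θ.toStage13Params p k s'.init)) (S₀, fun j => (ω j).2) (fun j => (ω j).1))
    (hζm : ∀ j Y, Measurable ((θ.zhAt p s').ζ0 j Y)) (hqm' : ∀ j Λ', Measurable ((θ.zhAt p s').quad j Λ'))
    (hΦm : ∀ S ∈ admSOfRecord F θ.ν θ.τ9.M (gOfRecord₁₃ F N θ.toStage13Params p) p.K (k + 1) s',
      Measurable fun ω : MultiCfg (F.P p.K) (SU N) (FluctV N) =>
        (sect2Operand F N (FluctV N) p.K (settingOfRecord₁₃ F N θ.toStage13Params p) (θ.rzAt p s') s' t' E'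
                  (UbgOfRecord₁₃CoP F N θ.toStage13Params p (k + 1) s')) (S, fun j => (ω j).2) (fun j => (ω j).1))
    -- PER OLD BRANCH AND a.e. FROZEN `y`: def-T's ONE-FIBRE CONDITIONAL EXPECTATION OF THE FROZEN PIECE IS THE INTRINSIC READING
    (hT : ∀ S₀ ∈ admSOfRecord F θ.ν θ.τ9.M (gOfRecord₁₃ F N θ.toStage13Params p) p.K k s'.init,
      ∀ᵐ y ∂(Measure.pi fun _ : ↥(Set.toFinite (bondsIn k (s'.Ω (k + 1))ᶜ)).toFinset => (HaarData.haar : Measure (SU N))),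
      kernelTransport (Measure.pi fun _ : {b : PBond (F.P p.K) k // b ∉ (Set.toFinite (bondsIn k (s'.Ω (k + 1))ᶜ)).toFinset} => (HaarData.haar : Measure (SU N)))
          (Measure.pi fun _ : {c : PBond (F.P p.K) (k + 1) // c ∉ (Set.toFinite (bondsIn (k + 1) (s'.Ω (k + 1))ᶜ)).toFinset} => (HaarData.haar : Measure (SU N)))
          (fun u => fun c : {c : PBond (F.P p.K) (k + 1) // c ∉ (Set.toFinite (bondsIn (k + 1) (s'.Ω (k + 1))ᶜ)).toFinset} =>
            (avOfRecord F N p.K k).avg ((MeasurableEquiv.piEquivPiSubtypeProd (fun _ : PBond (F.P p.K) k => SU N)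
              (· ∈ (Set.toFinite (bondsIn k (s'.Ω (k + 1))ᶜ)).toFinset)).symm (y, u)) c)
          (fun u => (fun U => wOfRecord₉ F N θ.toStage9Params p (gOfRecord₁₃ F N θ.toStage13Params p) k s' U ((avOfRecord F N p.K k).avg U) *
        (chiSeqOfRecord F N θ.ν θ.τ9.M (gOfRecord₁₃ F N θ.toStage13Params p) p.K k s'.init U *
          tkBranchOfRecord F N (FluctV N) θ.ν θ.τ9.M (gOfRecord₁₃ F N θ.toStage13Params p) p.K (WtOfRecord₁₃H F N θ p s'.init) s'.init S₀ k (fun ω => (sect2Operand F N (FluctV N) p.K (settingOfRecord₁₃ F N θ.toStage13Params p) (θ.rzAt p s'.init) s'.init (t s'.init) (Ek s'.init)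
            (UbgOfRecord₁₃CoP F N θ.toStage13Params p k s'.init)) (S₀, fun j => (ω j).2) (fun j => (ω j).1)) (baseCfg k U)))
            ((MeasurableEquiv.piEquivPiSubtypeProd (fun _ : PBond (F.P p.K) k => SU N)
              (· ∈ (Set.toFinite (bondsIn k (s'.Ω (k + 1))ᶜ)).toFinset)).symm (y, u)))
        =ᵐ[(Measure.pi fun _ : {c : PBond (F.P p.K) (k + 1) // c ∉ (Set.toFinite (bondsIn (k + 1) (s'.Ω (k + 1))ᶜ)).toFinset} => (HaarData.haar : Measure (SU N)))]
        fun v => ∑ Y ∈ (Set.toFinite {Y : Set (Site (F.P p.K) 0) | Y ∈ SClassOfRecord F θ.ν (gOfRecord₁₃ F N θ.toStage13Params p) p.K (k + 1) ∧ Y ⊆ s'.Ω (k + 1) ∩ (s'.Λ (k + 1))ᶜ}).toFinset,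
          zetaOp (genDataOfRecord F N (FluctV N) θ.ν θ.τ9.M (gOfRecord₁₃ F N θ.toStage13Params p) p.K (WtOfRecord₁₃H F N θ p s') s' (Function.update S₀ (k + 1) Y) k).ζ
            (aOp k (genDataOfRecord F N (FluctV N) θ.ν θ.τ9.M (gOfRecord₁₃ F N θ.toStage13Params p) p.K (WtOfRecord₁₃H F N θ p s') s' (Function.update S₀ (k + 1) Y) k).sA
              (genDataOfRecord F N (FluctV N) θ.ν θ.τ9.M (gOfRecord₁₃ F N θ.toStage13Params p) p.K (WtOfRecord₁₃H F N θ p s') s' (Function.update S₀ (k + 1) Y) k).w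
              (tkBranchOfRecord F N (FluctV N) θ.ν θ.τ9.M (gOfRecord₁₃ F N θ.toStage13Params p) p.K (WtOfRecord₁₃H F N θ p s') s'.init S₀ k
                (fun ω => (sect2Operand F N (FluctV N) p.K (settingOfRecord₁₃ F N θ.toStage13Params p) (θ.rzAt p s') s' t' E'
                  (UbgOfRecord₁₃CoP F N θ.toStage13Params p (k + 1) s')) (Function.update S₀ (k + 1) Y, fun j => (ω j).2) (fun j => (ω j).1))))
            (Function.update (baseCfg (k + 1) ((MeasurableEquiv.piEquivPiSubtypeProd (fun _ : PBond (F.P p.K) (k + 1) => SU N)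
              (· ∈ (Set.toFinite (bondsIn (k + 1) (s'.Ω (k + 1))ᶜ)).toFinset)).symm (avgRestrOfRecord F N p.K k (Set.toFinite (bondsIn k (s'.Ω (k + 1))ᶜ)).toFinset
                (Set.toFinite (bondsIn (k + 1) (s'.Ω (k + 1))ᶜ)).toFinset y, v))) k
            (Function.updateFinset ((baseCfg (V := FluctV N) (k + 1) ((MeasurableEquiv.piEquivPiSubtypeProd (fun _ : PBond (F.P p.K) (k + 1) => SU N)
              (· ∈ (Set.toFinite (bondsIn (k + 1) (s'.Ω (k + 1))ᶜ)).toFinset)).symm (avgRestrOfRecord F N p.K k (Set.toFinite (bondsIn k (s'.Ω (k + 1))ᶜ)).toFinset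
                (Set.toFinite (bondsIn (k + 1) (s'.Ω (k + 1))ᶜ)).toFinset y, v))) k).1 (Set.toFinite (bondsIn k (s'.Ω (k + 1))ᶜ)).toFinset y,
              ((baseCfg (V := FluctV N) (k + 1) ((MeasurableEquiv.piEquivPiSubtypeProd (fun _ : PBond (F.P p.K) (k + 1) => SU N)
              (· ∈ (Set.toFinite (bondsIn (k + 1) (s'.Ω (k + 1))ᶜ)).toFinset)).symm (avgRestrOfRecord F N p.K k (Set.toFinite (bondsIn k (s'.Ω (k + 1))ᶜ)).toFinset
                (Set.toFinite (bondsIn (k + 1) (s'.Ω (k + 1))ᶜ)).toFinset y, v))) k).2))) :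
    slotsTOfRecord F N θ.ν θ.τ9 (EOfRecord₁₃ F N θ.toStage13Params) (wOfRecord₉ F N θ.toStage9Params) θ.ppSel p (gOfRecord₁₃ F N θ.toStage13Params p) (k + 1) s' = 0 ∨
      ∀ᵐ V' ∂fieldMeasure (F.P p.K) (k + 1) (SU N),
        chiSeqOfRecord F N θ.ν θ.τ9.M (gOfRecord₁₃ F N θ.toStage13Params p) p.K (k + 1) s' V' ≠ 0 →
          slotsTOfRecord F N θ.ν θ.τ9 (EOfRecord₁₃ F N θ.toStage13Params) (wOfRecord₉ F N θ.toStage9Params) θ.ppSel p (gOfRecord₁₃ F N θ.toStage13Params p) (k + 1) s' V' =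
            sect2Slot F N (FluctV N) p.K (settingOfRecord₁₃ F N θ.toStage13Params p) (θ.rzAt p s') (WtOfRecord₁₃H F N θ p s') s' t' E'
              (UbgOfRecord₁₃CoP F N θ.toStage13Params p (k + 1) s') V' := by
  rcases (hform.2 s'.init).2 with h0 | hae
  · exact Or.inl (slotsTOfRecord_succ_eq_zero_of_init_eq_zero F N θ.ν θ.τ9 _ _ θ.ppSel p _ _ s' h0)
  -- the piece's rows are theorems of the core provisos
  have hG := hG_at_record₁₃_of_provisos θ h p hkK s'
  have hζ0 := zetaOfRecord_nonneg F N θ.ν θ.τ9.M h.zetaUnity h.zetaAbs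
  have hw0 : ∀ U, 0 ≤ wOfRecord₉ F N θ.toStage9Params p (gOfRecord₁₃ F N θ.toStage13Params p) k s' U ((avOfRecord F N p.K k).avg U) :=
    fun U => wOfRecord_nonneg F N θ.ν θ.τ9.M p _ k θ.A₁ hζ0 s' U _
  have hgr : Measurable fun U : GaugeField (F.P p.K) k (SU N) => ((avOfRecord F N p.K k).avg U, U) :=
    (avOfRecord_measurable F N p.K k).prodMk measurable_id
  have hwm : Measurable fun U => wOfRecord₉ F N θ.toStage9Params p (gOfRecord₁₃ F N θ.toStage13Params p) k s' U ((avOfRecord F N p.K k).avg U) := by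
    have h' := ((h.tstep p k hkK).measW s').comp hgr
    exact h'
  have hχm : Measurable fun U => chiSeqOfRecord F N θ.ν θ.τ9.M (gOfRecord₁₃ F N θ.toStage13Params p) p.K k s'.init U :=
    measurable_chiSeqOfRecord_of_localBg (localBgMeasurable F N θ.ν) θ.τ9.M _ p.K k s'.init
  have hG₀ := integrable_oldBranch_pieces₁₃H_of_integrable_graph θ p s' t Ek hG hae h.zhLaws hw0 hwm hχm hζ0m hqm hΦ₀m
  -- the intrinsic reading is measurable and nonnegative
  have hW := WtOfRecord₁₃H_laws h.zhLaws p s'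
  have hRm := fun S₀ (h₀ : S₀ ∈ admSOfRecord F θ.ν θ.τ9.M (gOfRecord₁₃ F N θ.toStage13Params p) p.K k s'.init) =>
    measurable_intrinsicReading_of_hgm θ.ν θ.τ9.M (gOfRecord₁₃ F N θ.toStage13Params p) p (hdec := hdec) (hdec' := hdec') s' (WtOfRecord₁₃H F N θ p s')
      (sect2Operand F N (FluctV N) p.K (settingOfRecord₁₃ F N θ.toStage13Params p) (θ.rzAt p s') s' t' E'
                  (UbgOfRecord₁₃CoP F N θ.toStage13Params p (k + 1) s')) (hgm_at_record₁₃_of_rows θ p (hdec := hdec) (hdec' := hdec') s' t' E' hζm hqm' hΦm) S₀ h₀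
  have hR0 : ∀ (S₀ : ℕ → Set (Site (F.P p.K) 0)) (z : ((↥(Set.toFinite (bondsIn k (s'.Ω (k + 1))ᶜ)).toFinset → SU N) × ({c : PBond (F.P p.K) (k + 1) // c ∉ (Set.toFinite (bondsIn (k + 1) (s'.Ω (k + 1))ᶜ)).toFinset} → SU N))), 0 ≤ ∑ Y ∈ (Set.toFinite {Y : Set (Site (F.P p.K) 0) | Y ∈ SClassOfRecord F θ.ν (gOfRecord₁₃ F N θ.toStage13Params p) p.K (k + 1) ∧ Y ⊆ s'.Ω (k + 1) ∩ (s'.Λ (k + 1))ᶜ}).toFinset,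
            zetaOp (genDataOfRecord F N (FluctV N) θ.ν θ.τ9.M (gOfRecord₁₃ F N θ.toStage13Params p) p.K (WtOfRecord₁₃H F N θ p s') s' (Function.update S₀ (k + 1) Y) k).ζ
              (aOp k (genDataOfRecord F N (FluctV N) θ.ν θ.τ9.M (gOfRecord₁₃ F N θ.toStage13Params p) p.K (WtOfRecord₁₃H F N θ p s') s' (Function.update S₀ (k + 1) Y) k).sA
                (genDataOfRecord F N (FluctV N) θ.ν θ.τ9.M (gOfRecord₁₃ F N θ.toStage13Params p) p.K (WtOfRecord₁₃H F N θ p s') s' (Function.update S₀ (k + 1) Y) k).w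
                (tkBranchOfRecord F N (FluctV N) θ.ν θ.τ9.M (gOfRecord₁₃ F N θ.toStage13Params p) p.K (WtOfRecord₁₃H F N θ p s') s'.init S₀ k
                  (fun ω => (sect2Operand F N (FluctV N) p.K (settingOfRecord₁₃ F N θ.toStage13Params p) (θ.rzAt p s') s' t' E'
                    (UbgOfRecord₁₃CoP F N θ.toStage13Params p (k + 1) s')) (Function.update S₀ (k + 1) Y, fun j => (ω j).2) (fun j => (ω j).1))))
              (Function.update (baseCfg (k + 1) ((MeasurableEquiv.piEquivPiSubtypeProd (fun _ : PBond (F.P p.K) (k + 1) => SU N)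
                (· ∈ (Set.toFinite (bondsIn (k + 1) (s'.Ω (k + 1))ᶜ)).toFinset)).symm (avgRestrOfRecord F N p.K k (Set.toFinite (bondsIn k (s'.Ω (k + 1))ᶜ)).toFinset
                  (Set.toFinite (bondsIn (k + 1) (s'.Ω (k + 1))ᶜ)).toFinset z.1, z.2))) k
              (Function.updateFinset ((baseCfg (V := FluctV N) (k + 1) ((MeasurableEquiv.piEquivPiSubtypeProd (fun _ : PBond (F.P p.K) (k + 1) => SU N)
                (· ∈ (Set.toFinite (bondsIn (k + 1) (s'.Ω (k + 1))ᶜ)).toFinset)).symm (avgRestrOfRecord F N p.K k (Set.toFinite (bondsIn k (s'.Ω (k + 1))ᶜ)).toFinset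
                  (Set.toFinite (bondsIn (k + 1) (s'.Ω (k + 1))ᶜ)).toFinset z.1, z.2))) k).1 (Set.toFinite (bondsIn k (s'.Ω (k + 1))ᶜ)).toFinset z.1,
                ((baseCfg (V := FluctV N) (k + 1) ((MeasurableEquiv.piEquivPiSubtypeProd (fun _ : PBond (F.P p.K) (k + 1) => SU N)
                (· ∈ (Set.toFinite (bondsIn (k + 1) (s'.Ω (k + 1))ᶜ)).toFinset)).symm (avgRestrOfRecord F N p.K k (Set.toFinite (bondsIn k (s'.Ω (k + 1))ᶜ)).toFinset
                  (Set.toFinite (bondsIn (k + 1) (s'.Ω (k + 1))ᶜ)).toFinset z.1, z.2))) k).2)) := fun S₀ z =>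
    Finset.sum_nonneg fun Y _ => by
      rw [zetaOp_apply]
      exact mul_nonneg ((genDataOfRecord_laws F N (FluctV N) θ.ν θ.τ9.M (gOfRecord₁₃ F N θ.toStage13Params p) p.K hW s' (Function.update S₀ (k + 1) Y) k).zeta_nonneg _)
        (aOp_nonneg k _ (genDataOfRecord_laws F N (FluctV N) θ.ν θ.τ9.M (gOfRecord₁₃ F N θ.toStage13Params p) p.K hW s' (Function.update S₀ (k + 1) Y) k).w_nonneg
          (tkBranchOfRecord_nonneg θ.ν θ.τ9.M (gOfRecord₁₃ F N θ.toStage13Params p) p.K hW s'.init S₀ k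
            (fun ω => (sect2Operand_pos p.K _ _ s' t' E' _ (Function.update S₀ (k + 1) Y, fun j => (ω j).2) (fun j => (ω j).1)).le)) _)
  exact slotsTOfRecord₁₃H_succ_O3_of_hasSect2FormAtZS_of_oldBranchCondExp_of_provisos θ h p hkK (hdec := hdec) (hdec' := hdec') hk s' hform t' E'
    hζ0m hqm hΦ₀m hζm hqm' hΦm fun S₀ h₀ =>
      condExp_identity_of_fibrewise_of_nonneg θ.ν θ.τ9.M (gOfRecord₁₃ F N θ.toStage13Params p) p (hdec := hdec) (hdec' := hdec') hk s' (hG₀ S₀ h₀) (hR0 S₀) (hRm S₀ h₀)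
        (fibrewise_at_record_of_fibreTransport_ae_eq (F := F) (N := N) p.K s' hk (hG₀ S₀ h₀) (hT S₀ h₀))

end Stage13

/-! ## §2  The first 𝐓-step: the one-fibre conditional-expectation identity with the old piece `w(s′)·ρ₀` -/

section FirstStep

/-- ★★★ **THE FIRST 𝐓-STEP's (O3′) DISJUNCTION FROM THE ONE-FIBRE CONDITIONAL-EXPECTATION IDENTITY** (old piece `w(s′)·ρ₀`, Theorem 1's base form discharged): p646357 §3 with the
weak identity produced by §0's `fibrewise_at_record_of_fibreTransport_ae_eq` — [I] Thm 1 + [II] as «𝔼[w(s′)ρ₀ | U|_{B₀(Ω₁ᶜ)} = y, Ū|_{B₁(Ω₁)} = ·] = R̃_∅(y,·)» on each fibre — for a.e. frozen `y = U|_{B_0(Ω^c_1)}` and every bounded measurable `h` of `V|_{B_1(Ω_1)}`: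
`∫ w(s′)(U,Ū)·ρ₀(U)·h(Ū|_{B_1(Ω_1)}) dU|_{B_0(Ω_1)} = ∫ R̃_∅(y,v₂)·h(v₂) dv₂` at `U = e⁻¹(y,u)` — [I] Thm 1 + [II] read FIBREWISE: the old variables off the large-field region frozen, the
small-field variables integrated against the averaging constraint. [cite: Balaban1988Convergent, Thm 1 p.262, (3.1) p.264, (3.23)–(3.25) p.270; Balaban1987RG1, Thm 1 p.258, §2 p.267] -/
theorem slotsTOfRecord₁₃H_one_O3_of_fibreCondExpRho_of_provisos (θ : Stage13HParams F N) (h : θ.Provisos₁₃CoPH F N) (p : B12.RunParams) (hK : 0 < p.K)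
    {hdec : DecidableEq (PBond (F.P p.K) 0)} {hdec' : DecidableEq (PBond (F.P p.K) 1)}
    (s' : SeqOfRecord F θ.ν θ.τ9.M (gOfRecord₁₃ F N θ.toStage13Params p) p.K 1)
    (u₁ : Sect2.TermValues (F.P p.K) (MatA N) (FluctV N) θ.τ9.M) (e₁ : ℝ)
    (hζ0m : ∀ j Y, Measurable ((θ.zhAt p s'.init).ζ0 j Y)) (hqm : ∀ j Λ', Measurable ((θ.zhAt p s'.init).quad j Λ'))
    (hζm : ∀ j Y, Measurable ((θ.zhAt p s').ζ0 j Y)) (hqm' : ∀ j Λ', Measurable ((θ.zhAt p s').quad j Λ'))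
    (hΦm : ∀ S ∈ admSOfRecord F θ.ν θ.τ9.M (gOfRecord₁₃ F N θ.toStage13Params p) p.K 1 s',
      Measurable fun ω : MultiCfg (F.P p.K) (SU N) (FluctV N) =>
        (sect2Operand F N (FluctV N) p.K (settingOfRecord₁₃ F N θ.toStage13Params p) (θ.rzAt p s') s' u₁ e₁
                  (UbgOfRecord₁₃CoP F N θ.toStage13Params p 1 s')) (S, fun j => (ω j).2) (fun j => (ω j).1))
    -- PER a.e. FROZEN `y`: def-T's ONE-FIBRE CONDITIONAL EXPECTATION OF THE FROZEN PIECE IS THE INTRINSIC READING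
    (hT : ∀ᵐ y ∂(Measure.pi fun _ : ↥(Set.toFinite (bondsIn 0 (s'.Ω 1)ᶜ)).toFinset => (HaarData.haar : Measure (SU N))),
      kernelTransport (Measure.pi fun _ : {b : PBond (F.P p.K) 0 // b ∉ (Set.toFinite (bondsIn 0 (s'.Ω 1)ᶜ)).toFinset} => (HaarData.haar : Measure (SU N)))
          (Measure.pi fun _ : {c : PBond (F.P p.K) 1 // c ∉ (Set.toFinite (bondsIn 1 (s'.Ω 1)ᶜ)).toFinset} => (HaarData.haar : Measure (SU N)))
          (fun u => fun c : {c : PBond (F.P p.K) 1 // c ∉ (Set.toFinite (bondsIn 1 (s'.Ω 1)ᶜ)).toFinset} =>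
            (avOfRecord F N p.K 0).avg ((MeasurableEquiv.piEquivPiSubtypeProd (fun _ : PBond (F.P p.K) 0 => SU N)
              (· ∈ (Set.toFinite (bondsIn 0 (s'.Ω 1)ᶜ)).toFinset)).symm (y, u)) c)
          (fun u => (fun U => wOfRecord₉ F N θ.toStage9Params p (gOfRecord₁₃ F N θ.toStage13Params p) 0 s' U ((avOfRecord F N p.K 0).avg U) *
            slotsOfRecord F N θ.ν θ.τ9 (EOfRecord₁₃ F N θ.toStage13Params) (wOfRecord₉ F N θ.toStage9Params) θ.ppSel p (gOfRecord₁₃ F N θ.toStage13Params p) 0 s'.init U)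
            ((MeasurableEquiv.piEquivPiSubtypeProd (fun _ : PBond (F.P p.K) 0 => SU N)
              (· ∈ (Set.toFinite (bondsIn 0 (s'.Ω 1)ᶜ)).toFinset)).symm (y, u)))
        =ᵐ[(Measure.pi fun _ : {c : PBond (F.P p.K) 1 // c ∉ (Set.toFinite (bondsIn 1 (s'.Ω 1)ᶜ)).toFinset} => (HaarData.haar : Measure (SU N)))]
        fun v => ∑ Y ∈ (Set.toFinite {Y : Set (Site (F.P p.K) 0) | Y ∈ SClassOfRecord F θ.ν (gOfRecord₁₃ F N θ.toStage13Params p) p.K 1 ∧ Y ⊆ s'.Ω 1 ∩ (s'.Λ 1)ᶜ}).toFinset,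
          zetaOp (genDataOfRecord F N (FluctV N) θ.ν θ.τ9.M (gOfRecord₁₃ F N θ.toStage13Params p) p.K (WtOfRecord₁₃H F N θ p s') s' (Function.update (fun _ => ∅) 1 Y) 0).ζ
            (aOp 0 (genDataOfRecord F N (FluctV N) θ.ν θ.τ9.M (gOfRecord₁₃ F N θ.toStage13Params p) p.K (WtOfRecord₁₃H F N θ p s') s' (Function.update (fun _ => ∅) 1 Y) 0).sA
              (genDataOfRecord F N (FluctV N) θ.ν θ.τ9.M (gOfRecord₁₃ F N θ.toStage13Params p) p.K (WtOfRecord₁₃H F N θ p s') s' (Function.update (fun _ => ∅) 1 Y) 0).w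
              (fun ω => (sect2Operand F N (FluctV N) p.K (settingOfRecord₁₃ F N θ.toStage13Params p) (θ.rzAt p s') s' u₁ e₁
                  (UbgOfRecord₁₃CoP F N θ.toStage13Params p 1 s')) (Function.update (fun _ => ∅) 1 Y, fun j => (ω j).2) (fun j => (ω j).1)))
            (Function.update (baseCfg 1 ((MeasurableEquiv.piEquivPiSubtypeProd (fun _ : PBond (F.P p.K) 1 => SU N)
              (· ∈ (Set.toFinite (bondsIn 1 (s'.Ω 1)ᶜ)).toFinset)).symm (avgRestrOfRecord F N p.K 0 (Set.toFinite (bondsIn 0 (s'.Ω 1)ᶜ)).toFinset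
                (Set.toFinite (bondsIn 1 (s'.Ω 1)ᶜ)).toFinset y, v))) 0
            (Function.updateFinset ((baseCfg (V := FluctV N) 1 ((MeasurableEquiv.piEquivPiSubtypeProd (fun _ : PBond (F.P p.K) 1 => SU N)
              (· ∈ (Set.toFinite (bondsIn 1 (s'.Ω 1)ᶜ)).toFinset)).symm (avgRestrOfRecord F N p.K 0 (Set.toFinite (bondsIn 0 (s'.Ω 1)ᶜ)).toFinset
                (Set.toFinite (bondsIn 1 (s'.Ω 1)ᶜ)).toFinset y, v))) 0).1 (Set.toFinite (bondsIn 0 (s'.Ω 1)ᶜ)).toFinset y,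
              ((baseCfg (V := FluctV N) 1 ((MeasurableEquiv.piEquivPiSubtypeProd (fun _ : PBond (F.P p.K) 1 => SU N)
              (· ∈ (Set.toFinite (bondsIn 1 (s'.Ω 1)ᶜ)).toFinset)).symm (avgRestrOfRecord F N p.K 0 (Set.toFinite (bondsIn 0 (s'.Ω 1)ᶜ)).toFinset
                (Set.toFinite (bondsIn 1 (s'.Ω 1)ᶜ)).toFinset y, v))) 0).2))) :
    slotsTOfRecord F N θ.ν θ.τ9 (EOfRecord₁₃ F N θ.toStage13Params) (wOfRecord₉ F N θ.toStage9Params) θ.ppSel p (gOfRecord₁₃ F N θ.toStage13Params p) 1 s' = 0 ∨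
      ∀ᵐ V' ∂fieldMeasure (F.P p.K) 1 (SU N),
        chiSeqOfRecord F N θ.ν θ.τ9.M (gOfRecord₁₃ F N θ.toStage13Params p) p.K 1 s' V' ≠ 0 →
          slotsTOfRecord F N θ.ν θ.τ9 (EOfRecord₁₃ F N θ.toStage13Params) (wOfRecord₉ F N θ.toStage9Params) θ.ppSel p (gOfRecord₁₃ F N θ.toStage13Params p) 1 s' V' =
            sect2Slot F N (FluctV N) p.K (settingOfRecord₁₃ F N θ.toStage13Params p) (θ.rzAt p s') (WtOfRecord₁₃H F N θ p s') s' u₁ e₁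
              (UbgOfRecord₁₃CoP F N θ.toStage13Params p 1 s') V' := by
  have hk : 0 + 1 ≤ (F.P p.K).m + (F.P p.K).K := by show 0 + 1 ≤ F.m + p.K; omega
  -- the graph `w(s′)·χ_0·ρ₀ = w(s′)·ρ₀` is `dU`-integrable under the core provisos
  have hG := hG_at_record₁₃_of_provisos θ h p hK s'
  have h1 : (fun U => wOfRecord₉ F N θ.toStage9Params p (gOfRecord₁₃ F N θ.toStage13Params p) 0 s' U ((avOfRecord F N p.K 0).avg U) *
        slotsOfRecord F N θ.ν θ.τ9 (EOfRecord₁₃ F N θ.toStage13Params) (wOfRecord₉ F N θ.toStage9Params) θ.ppSel p (gOfRecord₁₃ F N θ.toStage13Params p) 0 s'.init U) =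
      fun U => wOfRecord₉ F N θ.toStage9Params p (gOfRecord₁₃ F N θ.toStage13Params p) 0 s' U ((avOfRecord F N p.K 0).avg U) *
        (chiSeqOfRecord F N θ.ν θ.τ9.M (gOfRecord₁₃ F N θ.toStage13Params p) p.K 0 s'.init U *
          slotsOfRecord F N θ.ν θ.τ9 (EOfRecord₁₃ F N θ.toStage13Params) (wOfRecord₉ F N θ.toStage9Params) θ.ppSel p (gOfRecord₁₃ F N θ.toStage13Params p) 0 s'.init U) := by
    funext U; rw [chiSeqOfRecord_zero, one_mul]
  rw [← h1] at hG
  -- the intrinsic reading at the first step is measurable and nonnegative (`admSOfRecord_zero`, `𝐓_0 = 1`)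
  have hW := WtOfRecord₁₃H_laws h.zhLaws p s'
  have hmem : (fun _ => (∅ : Set (Site (F.P p.K) 0))) ∈ admSOfRecord F θ.ν θ.τ9.M (gOfRecord₁₃ F N θ.toStage13Params p) p.K 0 s'.init := by
    rw [admSOfRecord_zero, Finset.mem_singleton]
  have hRm := measurable_intrinsicReading_of_hgm θ.ν θ.τ9.M (gOfRecord₁₃ F N θ.toStage13Params p) p (hdec := hdec) (hdec' := hdec') s' (WtOfRecord₁₃H F N θ p s')
      (sect2Operand F N (FluctV N) p.K (settingOfRecord₁₃ F N θ.toStage13Params p) (θ.rzAt p s') s' u₁ e₁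
                  (UbgOfRecord₁₃CoP F N θ.toStage13Params p 1 s')) (hgm_at_record₁₃_of_rows θ p (hdec := hdec) (hdec' := hdec') s' u₁ e₁ hζm hqm' hΦm) _ hmem
  have hR0 : ∀ z : ((↥(Set.toFinite (bondsIn 0 (s'.Ω 1)ᶜ)).toFinset → SU N) × ({c : PBond (F.P p.K) 1 // c ∉ (Set.toFinite (bondsIn 1 (s'.Ω 1)ᶜ)).toFinset} → SU N)), 0 ≤ ∑ Y ∈ (Set.toFinite {Y : Set (Site (F.P p.K) 0) | Y ∈ SClassOfRecord F θ.ν (gOfRecord₁₃ F N θ.toStage13Params p) p.K 1 ∧ Y ⊆ s'.Ω 1 ∩ (s'.Λ 1)ᶜ}).toFinset,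
            zetaOp (genDataOfRecord F N (FluctV N) θ.ν θ.τ9.M (gOfRecord₁₃ F N θ.toStage13Params p) p.K (WtOfRecord₁₃H F N θ p s') s' (Function.update (fun _ => ∅) 1 Y) 0).ζ
              (aOp 0 (genDataOfRecord F N (FluctV N) θ.ν θ.τ9.M (gOfRecord₁₃ F N θ.toStage13Params p) p.K (WtOfRecord₁₃H F N θ p s') s' (Function.update (fun _ => ∅) 1 Y) 0).sA
                (genDataOfRecord F N (FluctV N) θ.ν θ.τ9.M (gOfRecord₁₃ F N θ.toStage13Params p) p.K (WtOfRecord₁₃H F N θ p s') s' (Function.update (fun _ => ∅) 1 Y) 0).w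
                (fun ω => (sect2Operand F N (FluctV N) p.K (settingOfRecord₁₃ F N θ.toStage13Params p) (θ.rzAt p s') s' u₁ e₁
                    (UbgOfRecord₁₃CoP F N θ.toStage13Params p 1 s')) (Function.update (fun _ => ∅) 1 Y, fun j => (ω j).2) (fun j => (ω j).1)))
              (Function.update (baseCfg 1 ((MeasurableEquiv.piEquivPiSubtypeProd (fun _ : PBond (F.P p.K) 1 => SU N)
                (· ∈ (Set.toFinite (bondsIn 1 (s'.Ω 1)ᶜ)).toFinset)).symm (avgRestrOfRecord F N p.K 0 (Set.toFinite (bondsIn 0 (s'.Ω 1)ᶜ)).toFinset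
                  (Set.toFinite (bondsIn 1 (s'.Ω 1)ᶜ)).toFinset z.1, z.2))) 0
              (Function.updateFinset ((baseCfg (V := FluctV N) 1 ((MeasurableEquiv.piEquivPiSubtypeProd (fun _ : PBond (F.P p.K) 1 => SU N)
                (· ∈ (Set.toFinite (bondsIn 1 (s'.Ω 1)ᶜ)).toFinset)).symm (avgRestrOfRecord F N p.K 0 (Set.toFinite (bondsIn 0 (s'.Ω 1)ᶜ)).toFinset
                  (Set.toFinite (bondsIn 1 (s'.Ω 1)ᶜ)).toFinset z.1, z.2))) 0).1 (Set.toFinite (bondsIn 0 (s'.Ω 1)ᶜ)).toFinset z.1,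
                ((baseCfg (V := FluctV N) 1 ((MeasurableEquiv.piEquivPiSubtypeProd (fun _ : PBond (F.P p.K) 1 => SU N)
                (· ∈ (Set.toFinite (bondsIn 1 (s'.Ω 1)ᶜ)).toFinset)).symm (avgRestrOfRecord F N p.K 0 (Set.toFinite (bondsIn 0 (s'.Ω 1)ᶜ)).toFinset
                  (Set.toFinite (bondsIn 1 (s'.Ω 1)ᶜ)).toFinset z.1, z.2))) 0).2)) := fun z =>
    Finset.sum_nonneg fun Y _ => by
      rw [zetaOp_apply]
      exact mul_nonneg ((genDataOfRecord_laws F N (FluctV N) θ.ν θ.τ9.M (gOfRecord₁₃ F N θ.toStage13Params p) p.K hW s' (Function.update (fun _ => ∅) 1 Y) 0).zeta_nonneg _)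
        (aOp_nonneg 0 _ (genDataOfRecord_laws F N (FluctV N) θ.ν θ.τ9.M (gOfRecord₁₃ F N θ.toStage13Params p) p.K hW s' (Function.update (fun _ => ∅) 1 Y) 0).w_nonneg
          (fun ω => (sect2Operand_pos p.K _ _ s' u₁ e₁ _ (Function.update (fun _ => ∅) 1 Y, fun j => (ω j).2) (fun j => (ω j).1)).le) _)
  exact slotsTOfRecord₁₃H_one_O3_of_condExpRho_of_provisos θ h p hK (hdec := hdec) (hdec' := hdec') s' u₁ e₁ hζ0m hqm hζm hqm' hΦm
    (condExp_identity_of_fibrewise_of_nonneg θ.ν θ.τ9.M (gOfRecord₁₃ F N θ.toStage13Params p) p (hdec := hdec) (hdec' := hdec') hk s' hG hR0 hRm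
      (fibrewise_at_record_of_fibreTransport_ae_eq (F := F) (N := N) p.K s' hk hG hT))

end FirstStep

end Summit.QuantumFields.YangMills.Theorems.BalabanUVNodesN11O3OfFibreCondExpAtRecord13

end
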